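import Summits.BirchSwinnertonDyer.BirchSwinnertonDyer.Theorems.ErratumRoadFiveKernelFromPrintBRamFree
import Summits.BirchSwinnertonDyer.BirchSwinnertonDyer.Theorems.ErratumRoadFiveIMCDivRoadFFCoreBRamFreeOfThm23SelfDualIrrK
import Summits.BirchSwinnertonDyer.BirchSwinnertonDyer.Theorems.Rank1ResidualIntModelReduction
import Summits.BirchSwinnertonDyer.Rank1Residual.X5.TwoAdicInstancesToolkit
import Literature.NumberTheory.EllipticCurves.Rank1Residual.X9NoEntry
import HarnessLib

/-!
# Route `ErratumRoadFive` (rung K2, `p ≥ 5`), crux `Rest3NoWitnessBranchAtFive` (item stmt-BirchSwinnertonDyer-19703):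
# a RUNG ON THE «RAM-FREE» ROAD — route p2's open input `P2OpenInputOnTreeAt E 5` at an explicit NEW_A pair
# `E : y² + xy = x³ + x² − 23x + 78` (`N = 30765 = 3·5·7·293 ≥ 5000`), `p = 5`, whose ONLY odd non-split
# multiplicative prime `q = 3` has `v₃(Δ_min) = 5` (so `E[5]` is UNRAMIFIED at `3`), modulo F4♯‡ + F3♯‡ + PUB
# (cell `bsd-stepL`, seat `bsd-stepL-imc-p1` g32; `--supports stmt-BirchSwinnertonDyer-19703 --as helper`)

HONEST FRAMING: THEOREMS ONLY (no definition, no named fact, no `sorry`, no `native_decide`; axioms standard); nothing is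
booked; BSD is NOT proved by any of this; the rung is ONE curve and closes no item and no census class. PARTITION (D-0054):
X11b@p≥5 (B9 ∕ N8) × the pair `([1,1,0,−23,78], 5)` × `p = 5 ∥ N = 30765` — types-the-object-of (an instance of crux 19703's
NEW_A rows: (ram) by the prime `7`, `E(ℚ₅)[5] = 0`, the odd non-split multiplicative witness `3` has `5 ∣ v₃(Δ_min)`); closes: none.

WHY THIS RUNG. The landed erratum road (`KernelFromPrint[B]`, rungs `65a1`, `5835a1`, `6615d1`) needs an odd NON-split multiplicative
`q ≠ p` at which `E[p]` is RAMIFIED (`¬ p ∣ v_q(Δ_min)`). This session's ram-free kernel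
(`ErratumRoadFiveKernelFromPrintBRamFree`, `…IMCDivRoadFFCoreBRamFreeOfThm23SelfDualIrrK`) drops the ramification clause: `ρ̄_{E,p}`
onto comes from ANY ramified multiplicative prime and (TAM-q) from non-splitness. This file exhibits ONE pair where the difference is
visible in the kernel: the only odd non-split multiplicative prime is `3`, with `v₃(Δ_min) = 5` — so `ErratumHypotheses E 5`'s
witness clause FAILS for `q = 3` (and `7`, `293` are split) and the pair lies in crux 19703 (`Rest3NoWitnessBranchAtFive`), not on
the landed road — while the ram-free road reaches it (`Ram` by `7`, `v₇(Δ_min) = 1`). `N = 30765 ≥ 5000` is OUTSIDE the printed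
per-curve verifications (Miller 2011 ∕ Creutz–Miller 2012: `N < 5000`), and at `p ∥ N` no class-wide printed theorem gives
`BSD(E, p)`. The Cremona label of the curve is not determined here (no curve database on the farm); the model was found by the
coefficient-box search of kit job j325246 (this seat) and its analytic rank `1` is PARI's `ellanalyticrank` — carried, as in every
rung, by the `ClassX11b` binder INSIDE the predicate, not provable in Lean today.

THE PAIR, KERNEL-DECIDED (§§1–2; `decide` ∕ `norm_num` on the literal integer model, through `IntModel.*`, `X5.Instances.*`,
`LocalTorsion.*`, `surj_of_irr_of_ram`): `Δ = −2491965 = −3⁵·5·7·293`, `c₄ = 1129`; `gcd(Δ, c₄) = 1` (globally minimal,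
semistable); `N = 30765 ≥ 5000`; `5` NON-split multiplicative; `3` NON-split multiplicative with `v₃(Δ_min) = 5`; `7` multiplicative
with `v₇(Δ_min) = 1` = the (ram) witness; (iv) `E(ℚ₅)[5] = 0` (non-split `5`); `#Ẽ(𝔽₂) = 2`, `a₂ = 1`, `X² − X + 2` root-free
mod `5` ⟹ `E[5]` irreducible (Mazur 1978 Prop. 6.3 (1)); hence `ρ̄_{E,5}` ONTO (irr ∧ ram).

THE RUNG (§3): `openInputOnTreeAt_N30765_5` — F4♯‡ (`Castella2018.erratumThm23_charIdeal_sigma_le_of_isTorsion_selfDual_irrK_OPEN`,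
OPEN: [FW21 Thm. 4.41] as printed) + F3♯‡ (`Castella2018.erratum_exists_frames_members_sigma_congruence_wt_ramFree`, PUB) + the LOCAL
fact (item 20495, proved) + Shapiro (theorem) + (VN_p) + the published ∕ cited facts of 19283 + Wuthrich Prop. 21 + JSW17 3.3.1 ⟹
`P2OpenInputOnTreeAt E 5`: one line from `KernelFromPrintBRamFree.openInputOnTreeAt_of_print_of_coreBRamFree` with `q = 3`, the
ram-free core shape of the pair from `P2.imcDivIntCoreFrameAtErratumDataBRamFree_of_thm23SelfDualIrrK_OPEN_of_framesWtRamFree_of_facts`.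
`_closed`: instances installed.

References: [Castella2018Erratum] Thm. 1.1 (i)–(iv), Thm. 2.3, (2.4)–(2.5) (pp. 1–4); [FouquetWan2021] arXiv:2107.13726 Thm. 4.41;
[Castella2018Exceptional] Thms. 2.10–2.11; [JetchevSkinnerWan2017] Thm. 3.3.1, §3.5, Thm. 6.1.6; [Wuthrich2014] Prop. 21;
[SilvermanAEC2009] VII.1 Rem. 1.1, VII.5 Prop. 5.1, VII.6.1; [Silverman1994] IV.10.2; [Mazur1978] Prop. 6.3 (1); [Serre1972]
Prop. 15; [Miller2011LMS] Thm. 1.2, §1.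
-/

set_option autoImplicit false
-- the Theorems namespace of this sub repeats the summit name by design (D-0017 nested layout)
set_option linter.dupNamespace false

noncomputable section

open scoped Classical

open WeierstrassCurve IsDedekindDomain NumberField
  Literature.NumberTheory.EllipticCurves Literature.NumberTheory.EllipticCurves.ModularForms
  Literature.NumberTheory.EllipticCurves.Rank1Residual
  Literature.NumberTheory.EllipticCurves.Rank1Residual.Typed
  Literature.NumberTheory.EllipticCurves.Wuthrich2014
  Literature.NumberTheory.EllipticCurves.Castella2018
  Literature.NumberTheory.EllipticCurves.JetchevSkinnerWan2017
  Literature.NumberTheory.GaloisRepresentations Literature.NumberTheory.GaloisCohomology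
  Summit.BirchSwinnertonDyer.Rank1Residual Summit.BirchSwinnertonDyer.Rank1Residual.X11b
  Summit.BirchSwinnertonDyer.BirchSwinnertonDyer.Rank1Residual.IntModel

namespace Summit.BirchSwinnertonDyer.BirchSwinnertonDyer.Theorems.RungN30765

/-! ## §1 The model `[1, 1, 0, −23, 78]` and its kernel-decided invariants

The curve is written LITERALLY throughout: `M = ⟨1, 1, 0, −23, 78⟩ : WeierstrassCurve ℤ`
(`y² + xy = x³ + x² − 23x + 78`) and `E = M ⊗ ℚ`. -/

/-- `Δ = −2491965 = −3⁵·5·7·293`. [cite: SilvermanAEC2009, III.1] -/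
theorem M_Δ : (⟨1, 1, 0, -23, 78⟩ : WeierstrassCurve ℤ).Δ = -2491965 := by decide

/-- `c₄ = 1129`. [cite: SilvermanAEC2009, III.1] -/
theorem M_c₄ : (⟨1, 1, 0, -23, 78⟩ : WeierstrassCurve ℤ).c₄ = 1129 := by decide

/-- The curve is elliptic (`Δ ≠ 0`). [cite: SilvermanAEC2009, III.1] -/
theorem isElliptic_M : ((⟨1, 1, 0, -23, 78⟩ : WeierstrassCurve ℤ).baseChange ℚ).IsElliptic := by
  rw [WeierstrassCurve.isElliptic_iff, baseChange_int_Δ, M_Δ]; norm_num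

/-- The model `[1, 1, 0, −23, 78]` is globally minimal (`gcd(Δ, c₄) = gcd(2491965, 1129) = 1`).
[cite: SilvermanAEC2009, VII.1 Remark 1.1] -/
theorem isGloballyMinimal_M :
    ((⟨1, 1, 0, -23, 78⟩ : WeierstrassCurve ℤ).baseChange ℚ).IsGloballyMinimal :=
  X5.Instances.isGloballyMinimal_baseChange_int_of_gcd_eq_one 1 1 0 (-23) 78 (by decide)

/-- `Δ` and `c₄` are coprime (a semistable model). [cite: SilvermanAEC2009, VII.5 Prop. 5.1(b)] -/
theorem M_coprime :
    IsCoprime (⟨1, 1, 0, -23, 78⟩ : WeierstrassCurve ℤ).Δ (⟨1, 1, 0, -23, 78⟩ : WeierstrassCurve ℤ).c₄ := by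
  rw [M_Δ, M_c₄, Int.isCoprime_iff_gcd_eq_one]; decide

/-- **`N = 30765 = 3·5·7·293`** (semistable: `N = rad Δ`). [cite: Silverman1994, IV.10.2 (a),(b)] -/
theorem conductorNorm_M [((⟨1, 1, 0, -23, 78⟩ : WeierstrassCurve ℤ).baseChange ℚ).IsElliptic] :
    ((⟨1, 1, 0, -23, 78⟩ : WeierstrassCurve ℤ).baseChange ℚ).conductorNorm ℤ = 30765 := by
  refine X5.Instances.conductorNorm_baseChange_int_of_isCoprime (⟨1, 1, 0, -23, 78⟩ : WeierstrassCurve ℤ)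
    M_coprime (k := 81) ?_ ?_ ?_
  · exact Nat.squarefree_mul_iff.mpr ⟨by norm_num, (show Nat.Prime 3 by norm_num).prime.squarefree,
      Nat.squarefree_mul_iff.mpr ⟨by norm_num, (show Nat.Prime 5 by norm_num).prime.squarefree,
        Nat.squarefree_mul_iff.mpr ⟨by norm_num, (show Nat.Prime 7 by norm_num).prime.squarefree,
          (show Nat.Prime 293 by norm_num).prime.squarefree⟩⟩⟩
  · rw [M_Δ]; norm_num
  · rw [M_Δ]; norm_num

/-- **`N ≥ 5000`**: the pair lies OUTSIDE the printed per-curve verifications of BSD (Miller 2011 ∕ Creutz–Miller 2012 ∕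
Lawson–Wuthrich 2016: `N < 5000`). [cite: Miller2011LMS, Thm. 1.2 and §1] -/
theorem conductorNorm_M_ge [((⟨1, 1, 0, -23, 78⟩ : WeierstrassCurve ℤ).baseChange ℚ).IsElliptic] :
    5000 ≤ ((⟨1, 1, 0, -23, 78⟩ : WeierstrassCurve ℤ).baseChange ℚ).conductorNorm ℤ := by
  rw [conductorNorm_M]; norm_num

/-! ## §2 Local data at `5`, `3`, `7`; the (ram) witness `7`; the ram-FREE witness `3`; (iv); `E[5]` irreducible; `ρ̄` onto -/

/-- **Multiplicative reduction at `5`** (`5 ∣ Δ`, `5 ∤ c₄ = 1129`). [cite: SilvermanAEC2009, VII.5 Prop. 5.1(b)] -/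
theorem mult_five [((⟨1, 1, 0, -23, 78⟩ : WeierstrassCurve ℤ).baseChange ℚ).IsElliptic]
    [((⟨1, 1, 0, -23, 78⟩ : WeierstrassCurve ℤ).baseChange ℚ).IsGloballyMinimal] :
    Mult ((⟨1, 1, 0, -23, 78⟩ : WeierstrassCurve ℤ).baseChange ℚ) 5 :=
  hasMultiplicativeReductionAtPrime_of_intModel (integralModelInt_baseChange_int _) 5
    (by rw [M_Δ]; decide) (by rw [M_c₄]; decide)

/-- **NON-split multiplicative at `5`** (node-tangent quadratic root-free mod `5`). [cite: SilvermanAEC2009, VII.5 Prop. 5.1(b)] -/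
theorem not_split_five [((⟨1, 1, 0, -23, 78⟩ : WeierstrassCurve ℤ).baseChange ℚ).IsElliptic]
    [((⟨1, 1, 0, -23, 78⟩ : WeierstrassCurve ℤ).baseChange ℚ).IsGloballyMinimal] :
    ¬ ((⟨1, 1, 0, -23, 78⟩ : WeierstrassCurve ℤ).baseChange ℚ).HasSplitMultiplicativeReductionAtPrime 5 :=
  not_hasSplitMultiplicativeReductionAtPrime_of_intModel_of_noroot (integralModelInt_baseChange_int _) 5
    (by rw [M_Δ]; decide) (by rw [M_c₄]; decide) (by decide)

/-- **Multiplicative reduction at `3`** (`3 ∣ Δ`, `3 ∤ c₄`). [cite: SilvermanAEC2009, VII.5 Prop. 5.1(b)] -/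
theorem mult_three [((⟨1, 1, 0, -23, 78⟩ : WeierstrassCurve ℤ).baseChange ℚ).IsElliptic]
    [((⟨1, 1, 0, -23, 78⟩ : WeierstrassCurve ℤ).baseChange ℚ).IsGloballyMinimal] :
    Mult ((⟨1, 1, 0, -23, 78⟩ : WeierstrassCurve ℤ).baseChange ℚ) 3 :=
  hasMultiplicativeReductionAtPrime_of_intModel (integralModelInt_baseChange_int _) 3
    (by rw [M_Δ]; decide) (by rw [M_c₄]; decide)

/-- **NON-split multiplicative at `3`** (node-tangent quadratic root-free mod `3`). [cite: SilvermanAEC2009, VII.5 Prop. 5.1(b)] -/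
theorem not_split_three [((⟨1, 1, 0, -23, 78⟩ : WeierstrassCurve ℤ).baseChange ℚ).IsElliptic]
    [((⟨1, 1, 0, -23, 78⟩ : WeierstrassCurve ℤ).baseChange ℚ).IsGloballyMinimal] :
    ¬ ((⟨1, 1, 0, -23, 78⟩ : WeierstrassCurve ℤ).baseChange ℚ).HasSplitMultiplicativeReductionAtPrime 3 :=
  not_hasSplitMultiplicativeReductionAtPrime_of_intModel_of_noroot (integralModelInt_baseChange_int _) 3
    (by rw [M_Δ]; decide) (by rw [M_c₄]; decide) (by decide)

/-- **Multiplicative reduction at `7`** (`7 ∣ Δ`, `7 ∤ c₄`). [cite: SilvermanAEC2009, VII.5 Prop. 5.1(b)] -/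
theorem mult_seven [((⟨1, 1, 0, -23, 78⟩ : WeierstrassCurve ℤ).baseChange ℚ).IsElliptic]
    [((⟨1, 1, 0, -23, 78⟩ : WeierstrassCurve ℤ).baseChange ℚ).IsGloballyMinimal] :
    Mult ((⟨1, 1, 0, -23, 78⟩ : WeierstrassCurve ℤ).baseChange ℚ) 7 :=
  haveI : Fact (Nat.Prime 7) := ⟨by norm_num⟩
  hasMultiplicativeReductionAtPrime_of_intModel (integralModelInt_baseChange_int _) 7
    (by rw [M_Δ]; decide) (by rw [M_c₄]; decide)

/-- **`v₃(Δ_min) = 5` — so `5 ∣ v₃(Δ_min)`: `E[5]` is UNRAMIFIED at the non-split prime `3`** (Tate); the landed erratum road's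
witness clause fails for `q = 3`. [cite: SilvermanAEC2009, VII.5 Prop. 5.1(b)] [cite: SilvermanATAEC1994, V.4–V.5 and Exercise 5.13(b)] -/
theorem padicValInt_three_minimalDiscriminant
    [((⟨1, 1, 0, -23, 78⟩ : WeierstrassCurve ℤ).baseChange ℚ).IsGloballyMinimal] :
    padicValInt 3 ((⟨1, 1, 0, -23, 78⟩ : WeierstrassCurve ℤ).baseChange ℚ).minimalDiscriminantInt = 5 := by
  rw [minimalDiscriminantInt_baseChange_int, M_Δ]
  exact padicValInt_eq_of_dvd_of_not_dvd 3 (by decide) (by decide)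

/-- `v₇(Δ_min) = 1` — so `5 ∤ v₇(Δ_min)`: `E[5]` is ramified at `7`. [cite: SilvermanAEC2009, VII.5 Prop. 5.1(b)] -/
theorem padicValInt_seven_minimalDiscriminant
    [((⟨1, 1, 0, -23, 78⟩ : WeierstrassCurve ℤ).baseChange ℚ).IsGloballyMinimal] :
    padicValInt 7 ((⟨1, 1, 0, -23, 78⟩ : WeierstrassCurve ℤ).baseChange ℚ).minimalDiscriminantInt = 1 := by
  rw [minimalDiscriminantInt_baseChange_int, M_Δ]
  exact padicValInt_eq_of_dvd_of_not_dvd 7 (by decide) (by decide)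

/-- `v₅(Δ_min) = 1`. [cite: SilvermanAEC2009, VII.5 Prop. 5.1(b)] -/
theorem padicValInt_five_minimalDiscriminant
    [((⟨1, 1, 0, -23, 78⟩ : WeierstrassCurve ℤ).baseChange ℚ).IsGloballyMinimal] :
    padicValInt 5 ((⟨1, 1, 0, -23, 78⟩ : WeierstrassCurve ℤ).baseChange ℚ).minimalDiscriminantInt = 1 := by
  rw [minimalDiscriminantInt_baseChange_int, M_Δ]
  exact padicValInt_eq_of_dvd_of_not_dvd 5 (by decide) (by decide)

/-- **The (ram) witness at `p = 5` is `7`** (`7 ≠ 5` multiplicative, `5 ∤ v₇(Δ_min) = 1`; `Rank1Residual.Ram`) — NOT the non-split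
prime `3`. [cite: SkinnerUrban2014, Thm. 2 (p. 3), second bullet] -/
theorem ram_five [((⟨1, 1, 0, -23, 78⟩ : WeierstrassCurve ℤ).baseChange ℚ).IsElliptic]
    [((⟨1, 1, 0, -23, 78⟩ : WeierstrassCurve ℤ).baseChange ℚ).IsGloballyMinimal] :
    Ram ((⟨1, 1, 0, -23, 78⟩ : WeierstrassCurve ℤ).baseChange ℚ) 5 :=
  ⟨7, ⟨by norm_num⟩, by decide, mult_seven, by rw [padicValInt_seven_minimalDiscriminant]; decide⟩

/-- **The landed road's witness clause FAILS at `q = 3`**: `5 ∣ v₃(Δ_min)`. [cite: Castella2018Erratum, Thm. 1.1 (iii) (p. 1)] -/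
theorem five_dvd_padicValInt_three [((⟨1, 1, 0, -23, 78⟩ : WeierstrassCurve ℤ).baseChange ℚ).IsGloballyMinimal] :
    (5 : ℕ) ∣ padicValInt 3 ((⟨1, 1, 0, -23, 78⟩ : WeierstrassCurve ℤ).baseChange ℚ).minimalDiscriminantInt := by
  rw [padicValInt_three_minimalDiscriminant]

/-- **Erratum hypothesis (iv) `E(ℚ₅)[5] = 0`** — `5` is a prime of NON-SPLIT multiplicative reduction
(`LocalTorsion.localTorsion_eq_zero_of_nonsplit`). [cite: SilvermanAEC2009, Thm VII.6.1 and Exercise 3.5]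
[cite: Castella2018Erratum, Thm. 1.1 (iv) (p. 1)] -/
theorem localTorsion_five [((⟨1, 1, 0, -23, 78⟩ : WeierstrassCurve ℤ).baseChange ℚ).IsElliptic]
    [((⟨1, 1, 0, -23, 78⟩ : WeierstrassCurve ℤ).baseChange ℚ).IsGloballyMinimal] :
    ∀ P : ((((⟨1, 1, 0, -23, 78⟩ : WeierstrassCurve ℤ).baseChange ℚ)).baseChange ℚ_[5]).toAffine.Point, 5 • P = 0 → P = 0 :=
  LocalTorsion.localTorsion_eq_zero_of_nonsplit _ 5 (by norm_num) mult_five not_split_five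

/-- `#Ẽ(𝔽₂) = 2` (`a₂ = 2 + 1 − 2 = 1`), kernel-decided on the `4` pairs of `𝔽₂²`. [cite: SilvermanAEC2009, V.2] -/
theorem card_F2 :
    Nat.card (((⟨1, 1, 0, -23, 78⟩ : WeierstrassCurve ℤ).map (Int.castRingHom (ZMod 2))).toAffine.Point) = 2 := by
  rw [@natCard_point_eq_one_add_card (ZMod 2) (@ZMod.instField 2 ⟨by norm_num⟩) _ _ _ (by decide)]
  decide

/-- **`E[5]` irreducible**: Frobenius no-root witness at the good prime `ℓ = 2` (`a₂ = 1`, `X² − X + 2` root-free mod `5`;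
Mazur 1978 Prop. 6.3 (1)). [cite: Mazur1978, §5 (p. 148) and §6 Prop. 6.3 (1) (p. 153)] -/
theorem irr_five [((⟨1, 1, 0, -23, 78⟩ : WeierstrassCurve ℤ).baseChange ℚ).IsElliptic]
    [((⟨1, 1, 0, -23, 78⟩ : WeierstrassCurve ℤ).baseChange ℚ).IsGloballyMinimal] :
    Irr ((⟨1, 1, 0, -23, 78⟩ : WeierstrassCurve ℤ).baseChange ℚ) 5 :=
  haveI : Fact (Nat.Prime 2) := ⟨by norm_num⟩
  hasIrreducibleModPGaloisRep_of_intModel_of_noroot (integralModelInt_baseChange_int _) 5 2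
    (by decide) (by rw [M_Δ]; decide) card_F2 (by decide)

/-- **`ρ̄_{E,5}` is onto** (irr(5) ∧ ram(5) through the prime `7`; `surj_of_irr_of_ram`), so the open input at this pair is NOT
vacuous and hypothesis (i) of F4♯‡ holds at every Hida member. [cite: Serre1972, §2.4 Prop. 15] -/
theorem surj_five [((⟨1, 1, 0, -23, 78⟩ : WeierstrassCurve ℤ).baseChange ℚ).IsElliptic]
    [((⟨1, 1, 0, -23, 78⟩ : WeierstrassCurve ℤ).baseChange ℚ).IsGloballyMinimal] :
    Surj ((⟨1, 1, 0, -23, 78⟩ : WeierstrassCurve ℤ).baseChange ℚ) 5 :=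
  surj_of_irr_of_ram _ 5 irr_five ram_five

/-! ## §3 The rung: the open input at `([1,1,0,−23,78], 5)` by the ram-free road, modulo F4♯‡ + F3♯‡ + published facts -/

/-- **RUNG OF CRUX 19703 ON THE RAM-FREE ROAD at the NEW_A pair `([1,1,0,−23,78], 5)`, OUTSIDE every printed per-curve
verification (`N = 30765 ≥ 5000`).** For this `E` (`r_an = 1` carried by the `ClassX11b` binder inside the predicate), `p = 5`
(non-split multiplicative, `E[5]` irreducible, `ρ̄_{E,5}` onto through the (ram) prime `7`), the odd NON-split multiplicative
witness `q = 3` with `5 ∣ v₃(Δ_min)` (E[5] UNRAMIFIED at `3`: NOT a datum of the landed road) and (iv) `E(ℚ₅)[5] = 0`: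
F4♯‡ (OPEN, [FW21 Thm. 4.41] as printed) + F3♯‡ (PUB) + the local fact (item 20495, proved) + Shapiro (SU14 Prop. 3.2.3, a
theorem: `prop323_XAc_equiv_XBigDecomp_holds`) + GZK ∕ modularity ∕ Poitou–Tate + (VN_p) + the published ∕ cited bundle of
19283 + Wuthrich Prop. 21 + JSW17 3.3.1 ⟹ `P2OpenInputOnTreeAt E 5`. CONDITIONAL on F4♯‡ and the named facts; closes no
item; BSD is not proved by any of this. [cite: Castella2018Erratum, Thm. 1.1, Thm. 2.3, (2.4)–(2.5) (pp. 1–4)]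
[cite: FouquetWan2021, Thm. 4.41] [cite: JetchevSkinnerWan2017, Thm. 3.3.1 with §3.5 (3.5.c)] [cite: Wuthrich2014, Prop. 21 (p. 400)]
[cite: Miller2011LMS, Thm. 1.2 and §1] -/
theorem openInputOnTreeAt_N30765_5
    (h23 : erratumThm23_charIdeal_sigma_le_of_isTorsion_selfDual_irrK_OPEN)
    (hL : erratum_exists_frames_members_sigma_congruence_wt_ramFree)
    (hloc : sigmaLocal_charIdeal_eulerFactor_mem_of_noTamagawaDefect)
    (hVN : castella2018Exceptional_bdpValueContinuity_trivialChar)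
    (hF : GrossZagier1986_thm_I_7_3 ∧ rank_eq_analyticRank_of_analyticRank_le_one ∧
      Skinner2016.thmC_padicValRat_bsd_rank_zero ∧ exists_isNewformOf ∧
      CaiShuTian2014.thm11_trivialChar ∧ friedbergHoffstein_exists_twist_ne_zero_ramifiedAt ∧
      mazur_not_dvd_maninConstant_of_odd ∧
      (∀ (N : ℕ) [NeZero N] (W : WeierstrassCurve ℚ) (K : Type) [Field K] [NumberField K],
        gross_zagier N W K) ∧
      (∀ (N : ℕ) [NeZero N] (W : WeierstrassCurve ℚ) (K : Type) [Field K] [NumberField K],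
        kolyvagin N W K) ∧
      (∀ (N : ℕ) [NeZero N] (W : WeierstrassCurve ℚ) (K : Type) [Field K] [NumberField K],
        Kolyvagin1990_padicValNat_card_sha_le N W K) ∧
      HoffsteinLuo1997_exists_twist_L_one_ne_zero ∧
      (∀ (K : Type) [Field K] [NumberField K], poitouTate_sum_localTatePairing_eq_zero K) ∧
      (∀ (K : Type) [Field K] [NumberField K], poitouTate_selmerStructure_duality K) ∧
      (∀ (K : Type) [Field K] [NumberField K], poitouTate_sha_tateDual K) ∧
      (∀ (K : Type) [Field K] [NumberField K] (v : HeightOneSpectrum (𝓞 K)),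
        localEulerPoincareCharacteristic (v.adicCompletion K)) ∧
      fieldCdLE_two_of_numberField)
    (hWu : sha_dvd_analyticSha) (h331 : thm331_anticyclotomicControl_mult)
    [((⟨1, 1, 0, -23, 78⟩ : WeierstrassCurve ℤ).baseChange ℚ).IsElliptic]
    [((⟨1, 1, 0, -23, 78⟩ : WeierstrassCurve ℤ).baseChange ℚ).IsGloballyMinimal] :
    P2OpenInputOnTreeAt ((⟨1, 1, 0, -23, 78⟩ : WeierstrassCurve ℤ).baseChange ℚ) 5 :=
  haveI : Fact (Nat.Prime 3) := ⟨by norm_num⟩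
  KernelFromPrintBRamFree.openInputOnTreeAt_of_print_of_coreBRamFree hVN _ 5
    (P2.imcDivIntCoreFrameAtErratumDataBRamFree_of_thm23SelfDualIrrK_OPEN_of_framesWtRamFree_of_facts h23 hL hloc
      SkinnerUrban2014.prop323_XAc_equiv_XBigDecomp_holds hF.2.1 hF.2.2.2.1 hF.2.2.2.2.2.2.2.2.2.2.2.2.1
      hF.2.2.2.2.2.2.2.2.2.2.2.2.2.1 _ 5)
    hF hWu h331 ram_five localTorsion_five (q := 3) (by decide) (by decide) mult_three not_split_three

/-- **Closed form** — the two instance facts INSTALLED (`isElliptic_M`, `isGloballyMinimal_M` of §1), so that the statement displays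
no instance binder. CONDITIONAL; closes nothing. [cite: Castella2018Erratum, Thm. 1.1, Thm. 2.3, (2.4) (pp. 1–4)] -/
theorem openInputOnTreeAt_N30765_5_closed
    (h23 : erratumThm23_charIdeal_sigma_le_of_isTorsion_selfDual_irrK_OPEN)
    (hL : erratum_exists_frames_members_sigma_congruence_wt_ramFree)
    (hloc : sigmaLocal_charIdeal_eulerFactor_mem_of_noTamagawaDefect)
    (hVN : castella2018Exceptional_bdpValueContinuity_trivialChar)
    (hF : GrossZagier1986_thm_I_7_3 ∧ rank_eq_analyticRank_of_analyticRank_le_one ∧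
      Skinner2016.thmC_padicValRat_bsd_rank_zero ∧ exists_isNewformOf ∧
      CaiShuTian2014.thm11_trivialChar ∧ friedbergHoffstein_exists_twist_ne_zero_ramifiedAt ∧
      mazur_not_dvd_maninConstant_of_odd ∧
      (∀ (N : ℕ) [NeZero N] (W : WeierstrassCurve ℚ) (K : Type) [Field K] [NumberField K],
        gross_zagier N W K) ∧
      (∀ (N : ℕ) [NeZero N] (W : WeierstrassCurve ℚ) (K : Type) [Field K] [NumberField K],
        kolyvagin N W K) ∧
      (∀ (N : ℕ) [NeZero N] (W : WeierstrassCurve ℚ) (K : Type) [Field K] [NumberField K],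
        Kolyvagin1990_padicValNat_card_sha_le N W K) ∧
      HoffsteinLuo1997_exists_twist_L_one_ne_zero ∧
      (∀ (K : Type) [Field K] [NumberField K], poitouTate_sum_localTatePairing_eq_zero K) ∧
      (∀ (K : Type) [Field K] [NumberField K], poitouTate_selmerStructure_duality K) ∧
      (∀ (K : Type) [Field K] [NumberField K], poitouTate_sha_tateDual K) ∧
      (∀ (K : Type) [Field K] [NumberField K] (v : HeightOneSpectrum (𝓞 K)),
        localEulerPoincareCharacteristic (v.adicCompletion K)) ∧
      fieldCdLE_two_of_numberField)
    (hWu : sha_dvd_analyticSha) (h331 : thm331_anticyclotomicControl_mult) :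
    @P2OpenInputOnTreeAt ((⟨1, 1, 0, -23, 78⟩ : WeierstrassCurve ℤ).baseChange ℚ)
      isElliptic_M isGloballyMinimal_M 5 _ :=
  haveI := isElliptic_M
  haveI := isGloballyMinimal_M
  openInputOnTreeAt_N30765_5 h23 hL hloc hVN hF hWu h331

end Summit.BirchSwinnertonDyer.BirchSwinnertonDyer.Theorems.RungN30765

end
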